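import Summits.Ventures.PercRepro.RankLevelSetHallLostInj

/-!
# PercRepro — THE COLOOP REDUCTION OF THE LOST-SET INJECTION: `(INJ)` FOR `M ＼ e` AT THE CELL `(p − 1, q)` GIVES
`(INJ)` FOR `M` AT `(p, q)` WHEN `e` IS A COLOOP, HENCE `(INJ)` AND THE UP-HALL FORM OF C-044 FOR EVERY MATROID OF RANK
`p` WITH AT LEAST `k − 1 = p − q − 1` COLOOPS (p4, gen 34; paper proofs/P4-CELL-THREE.md §14.21)

At the tight layer `#E = p + q` with `r(M) = p`, a coloop `e` lies in every basis, so in the complement `E ∖ Z` of every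
member `Z` and in NO lost set (a lost set lies in the closure of a member).  Deleting `e` lands in the tight layer of the
cell `(p − 1, q)`: the members of `M` are members of `M ＼ e`, the lost sets of size `≤ p − 2` are lost sets of `M ＼ e`, and
`T ↦ insert e T` sends the big `Y`-sets of `M ＼ e` (cell `(p − 1, q)`) to big `Y`-sets of `M` (rank up by one).  Given an
injection `φ'` for `M ＼ e`, the map `S ↦ insert e S` on the lost sets of size `p − 1` (rank `q + 1`, size `p`) and
`S ↦ insert e (φ' S)` on the smaller ones is an injection for `M`: the two kinds never collide because the first has rank
`q + 1` and the second rank `> q + 1` after removing `e`... more precisely `insert e S = insert e (φ' S')` forces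
`S = φ' S'`, of rank `q` and `> q` at once.  Iterating from the vacuous cell `p ≤ q + 1` (no set of size strictly between
`q` and `p`), every matroid of rank `p` with at least `p − q − 1` coloops satisfies `(INJ)` and therefore the UP-Hall form
`Φ(p,q)·#𝒜 ≤ #upNbhd(𝒜)` through `hallUp_of_ncard_eq_of_lostInj`.
* `eRk_insert_eq_add_one_of_isColoop`, `notMem_of_mem_cellMembers_of_isColoop`, `notMem_of_mem_lostSets_of_isColoop`;
* `eRank_delete_of_isColoop`, `ncard_ground_delete`, `mem_cellMembers_delete_of_isColoop`, `mem_lostSets_delete_of_isColoop`,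
  `insert_mem_bigY_of_mem_bigY_delete`, `insert_mem_bigY_of_mem_lostSets_of_ncard`;
* **`lostInj_of_isColoop`** — `#E = p + q`, `q < p`, `r(M) = p`, `e` a coloop, `LostInj (M ＼ {e}) (p − 1) q` ⇒ `LostInj M p q`;
* `lostSets_eq_empty_of_le`, `lostInj_of_le` (the vacuous cells), `isColoop_delete_of_isColoop`;
* **`lostInj_of_coloops`** — a set `C` of coloops with `p ≤ q + 1 + #C` ⇒ `LostInj M p q`;
* **`hallUp_of_ncard_eq_of_coloops`** — the UP-Hall form for every family of members of such a matroid.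
Axioms: standard.
-/

namespace PercRepro

open Set Matroid

variable {α : Type} (M : Matroid α) [M.Finite]

omit [M.Finite] in
/-- A coloop `e ∉ X` raises the rank by one. -/
theorem eRk_insert_eq_add_one_of_isColoop {e : α} (he : M.IsColoop e) {X : Set α} (hX : e ∉ X) :
    M.eRk (insert e X) = M.eRk X + 1 :=
  eRk_insert_eq_add_one ⟨he.mem_ground, he.notMem_closure_of_notMem hX⟩

/-- At the tight layer of a rank-`p` matroid a coloop lies in no member (the complement of a member is a basis). -/
theorem notMem_of_mem_cellMembers_of_isColoop {p q : ℕ} (hE : M.E.ncard = p + q) (hR : M.eRank = (p : ℕ∞)) {e : α}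
    (he : M.IsColoop e) {Z : Set α} (hZ : Z ∈ cellMembers M p q) : e ∉ Z := by
  obtain ⟨hind, -⟩ := compl_indep_of_mem_U M hE hZ
  have hfin : (M.E \ Z).Finite := (M.set_finite M.E).subset sdiff_subset
  have hB : M.IsBase (M.E \ Z) := hind.isBase_of_eRk_ge hfin (by rw [hR, hZ.2.2])
  exact (he.mem_of_isBase hB).2

/-- At the tight layer of a rank-`p` matroid a coloop lies in no lost set. -/
theorem notMem_of_mem_lostSets_of_isColoop {p q : ℕ} (hE : M.E.ncard = p + q) (hR : M.eRank = (p : ℕ∞)) {e : α}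
    (he : M.IsColoop e) {S : Set α} (hS : S ∈ lostSets M p q) : e ∉ S := by
  intro heS
  obtain ⟨-, hSq, -, -, Z, hZ, hZS⟩ := hS
  have heZ : e ∉ Z := notMem_of_mem_cellMembers_of_isColoop M hE hR he hZ
  have h1 : M.eRk (insert e Z) = (q : ℕ∞) + 1 := by rw [eRk_insert_eq_add_one_of_isColoop M he heZ, hZ.2.1]
  have h2 : M.eRk (insert e Z) ≤ M.eRk S := M.eRk_mono (insert_subset heS hZS)
  rw [h1, hSq] at h2
  have h3 : (q : ℕ∞) + 1 ≤ (q : ℕ∞) := h2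
  have h4 : ((q + 1 : ℕ) : ℕ∞) ≤ (q : ℕ∞) := by exact_mod_cast h3
  have h5 : q + 1 ≤ q := by exact_mod_cast h4
  omega

omit [M.Finite] in
/-- The ground set of `M ＼ {e}` has one element fewer. -/
theorem ncard_ground_delete {p q : ℕ} (hE : M.E.ncard = p + q) {e : α} (heE : e ∈ M.E) :
    (M ＼ {e}).E.ncard = p + q - 1 := by
  rw [delete_ground, ncard_sdiff_singleton_of_mem heE, hE]

omit [M.Finite] in
/-- Deleting a coloop lowers the rank by exactly one. -/
theorem eRank_delete_of_isColoop {p : ℕ} (hR : M.eRank = (p : ℕ∞)) (hp : 1 ≤ p) {e : α} (he : M.IsColoop e) :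
    (M ＼ {e}).eRank = ((p - 1 : ℕ) : ℕ∞) := by
  rw [delete_eq_restrict, eRank_restrict]
  have heE := he.mem_ground
  have h1 : M.eRk M.E = M.eRk (M.E \ {e}) + 1 := by
    rw [← eRk_insert_eq_add_one_of_isColoop M he (X := M.E \ {e}) (by simp), insert_sdiff_singleton, insert_eq_of_mem heE]
  rw [eRk_ground, hR] at h1
  have h2 : ((p - 1 : ℕ) : ℕ∞) + 1 = M.eRk (M.E \ {e}) + 1 := by
    rw [← h1, ← Nat.cast_add_one, Nat.sub_add_cancel hp]
  exact (WithTop.add_right_cancel WithTop.one_ne_top h2).symm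

omit [M.Finite] in
/-- The rank of a subset of `M.E \ D` is unchanged by the deletion. -/
theorem eRk_delete_of_subset {D X : Set α} (hX : X ⊆ M.E \ D) : (M ＼ D).eRk X = M.eRk X := by
  rw [delete_eq_restrict, restrict_eRk_eq M hX]

omit [M.Finite] in
/-- A member of `M` avoiding the coloop `e` is a member of `M ＼ {e}` at the cell `(p − 1, q)`. -/
theorem mem_cellMembers_delete_of_isColoop {p q : ℕ} {e : α} (he : M.IsColoop e) {Z : Set α}
    (hZ : Z ∈ cellMembers M p q) (heZ : e ∉ Z) : Z ∈ cellMembers (M ＼ {e}) (p - 1) q := by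
  obtain ⟨hZE, hZq, hZp⟩ := hZ
  have heE := he.mem_ground
  have hZE' : Z ⊆ M.E \ {e} := subset_sdiff_singleton hZE heZ
  refine ⟨by rwa [delete_ground], ?_, ?_⟩
  · rw [eRk_delete_of_subset M hZE', hZq]
  · rw [delete_ground, eRk_delete_of_subset M sdiff_subset]
    have heA : e ∉ (M.E \ {e}) \ Z := fun h => h.1.2 rfl
    have h1 : M.eRk (M.E \ Z) = M.eRk ((M.E \ {e}) \ Z) + 1 := by
      rw [← eRk_insert_eq_add_one_of_isColoop M he heA]
      congr 1
      ext x
      simp only [mem_insert_iff, mem_sdiff, mem_singleton_iff]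
      constructor
      · rintro ⟨hxE, hxZ⟩
        by_cases hxe : x = e
        · exact Or.inl hxe
        · exact Or.inr ⟨⟨hxE, hxe⟩, hxZ⟩
      · rintro (rfl | ⟨⟨hxE, -⟩, hxZ⟩)
        · exact ⟨heE, heZ⟩
        · exact ⟨hxE, hxZ⟩
    rw [hZp] at h1
    have hp : 1 ≤ p := by
      by_contra hp0
      have hp0' : p = 0 := by omega
      rw [hp0', Nat.cast_zero] at h1
      have h3 : (0 : ℕ∞) < M.eRk ((M.E \ {e}) \ Z) + 1 := lt_of_lt_of_le zero_lt_one le_add_self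
      exact absurd h1 h3.ne
    have h2 : ((p - 1 : ℕ) : ℕ∞) + 1 = M.eRk ((M.E \ {e}) \ Z) + 1 := by
      rw [← h1, ← Nat.cast_add_one, Nat.sub_add_cancel hp]
    exact (WithTop.add_right_cancel WithTop.one_ne_top h2).symm

/-- A lost set of `M` of size `< p − 1` (which avoids the coloop `e`) is a lost set of `M ＼ {e}` at the cell `(p − 1, q)`. -/
theorem mem_lostSets_delete_of_isColoop {p q : ℕ} (hE : M.E.ncard = p + q) (hR : M.eRank = (p : ℕ∞)) {e : α}
    (he : M.IsColoop e) {S : Set α} (hS : S ∈ lostSets M p q) (hcard : S.ncard < p - 1) :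
    S ∈ lostSets (M ＼ {e}) (p - 1) q := by
  have heS : e ∉ S := notMem_of_mem_lostSets_of_isColoop M hE hR he hS
  obtain ⟨hSE, hSq, hqS, -, Z, hZ, hZS⟩ := hS
  have hSE' : S ⊆ M.E \ {e} := subset_sdiff_singleton hSE heS
  refine ⟨by rwa [delete_ground], by rw [eRk_delete_of_subset M hSE', hSq], hqS, hcard, Z, ?_, hZS⟩
  exact mem_cellMembers_delete_of_isColoop M he hZ (fun h => heS (hZS h))

/-- `T ↦ insert e T` sends the big `Y`-sets of `M ＼ {e}` at `(p − 1, q)` to big `Y`-sets of `M` at `(p, q)`. -/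
theorem insert_mem_bigY_of_mem_bigY_delete {p q : ℕ} {e : α} (he : M.IsColoop e) {T : Set α}
    (hT : T ∈ bigY (M ＼ {e}) (p - 1) q) : insert e T ∈ bigY M p q := by
  obtain ⟨⟨hTE, hqT, hTp⟩, hcard⟩ := hT
  rw [delete_ground] at hTE
  have heT : e ∉ T := fun h => (hTE h).2 rfl
  have hTE' : T ⊆ M.E := hTE.trans sdiff_subset
  have hTfin : T.Finite := (M.set_finite M.E).subset hTE'
  rw [eRk_delete_of_subset M hTE] at hqT hTp
  have hins : M.eRk (insert e T) = M.eRk T + 1 := eRk_insert_eq_add_one_of_isColoop M he heT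
  -- the rank of `T` is a natural number
  have hTtop : M.eRk T ≠ ⊤ := ((M.eRk_le_encard T).trans_lt hTfin.encard_lt_top).ne
  obtain ⟨n, hn⟩ : ∃ n : ℕ, M.eRk T = n := ⟨(M.eRk T).toNat, (ENat.coe_toNat hTtop).symm⟩
  rw [hn] at hqT hTp hins
  have hqn : q < n := by exact_mod_cast hqT
  have hnp : n < p - 1 := by exact_mod_cast hTp
  refine ⟨⟨insert_subset he.mem_ground hTE', ?_, ?_⟩, ?_⟩
  · rw [hins, ← Nat.cast_succ]; exact_mod_cast (by omega : q < n + 1)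
  · rw [hins, ← Nat.cast_succ]; exact_mod_cast (by omega : n + 1 < p)
  · rw [ncard_insert_of_notMem heT hTfin]; omega

/-- A lost set of size `p − 1` becomes a big `Y`-set of `M` by adjoining the coloop (rank `q + 1`, size `p`). -/
theorem insert_mem_bigY_of_mem_lostSets_of_ncard {p q : ℕ} (hE : M.E.ncard = p + q) (hR : M.eRank = (p : ℕ∞))
    {e : α} (he : M.IsColoop e) {S : Set α} (hS : S ∈ lostSets M p q) (hcard : S.ncard = p - 1) :
    insert e S ∈ bigY M p q := by
  have heS : e ∉ S := notMem_of_mem_lostSets_of_isColoop M hE hR he hS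
  obtain ⟨hSE, hSq, hqS, hSp, -⟩ := hS
  have hSfin : S.Finite := (M.set_finite M.E).subset hSE
  have hins : M.eRk (insert e S) = (q : ℕ∞) + 1 := by rw [eRk_insert_eq_add_one_of_isColoop M he heS, hSq]
  refine ⟨⟨insert_subset he.mem_ground hSE, ?_, ?_⟩, ?_⟩
  · rw [hins, ← Nat.cast_succ]; exact_mod_cast (by omega : q < q + 1)
  · rw [hins, ← Nat.cast_succ]; exact_mod_cast (by omega : q + 1 < p)
  · rw [ncard_insert_of_notMem heS hSfin]; omega

/-- **The coloop reduction of (INJ)**: at the tight layer `#E = p + q` of a rank-`p` matroid with a coloop `e`, an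
injection of the lost sets of `M ＼ {e}` (cell `(p − 1, q)`) into its big `Y`-sets gives one for `M` (cell `(p, q)`):
the lost sets of size `p − 1` go to `insert e S`, the smaller ones to `insert e (φ' S)`. -/
theorem lostInj_of_isColoop {p q : ℕ} (hE : M.E.ncard = p + q) (hR : M.eRank = (p : ℕ∞)) {e : α}
    (he : M.IsColoop e) (h : LostInj (M ＼ {e}) (p - 1) q) : LostInj M p q := by
  classical
  obtain ⟨φ', hφ', hinj'⟩ := h
  refine ⟨fun S => if S.ncard = p - 1 then insert e S else insert e (φ' S), ?_, ?_⟩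
  · intro S hS
    dsimp only
    by_cases hcard : S.ncard = p - 1
    · rw [if_pos hcard]
      exact ⟨insert_mem_bigY_of_mem_lostSets_of_ncard M hE hR he hS hcard, subset_insert e S⟩
    · rw [if_neg hcard]
      have hlt : S.ncard < p - 1 := by have := hS.2.2.2.1; omega
      have hS' := mem_lostSets_delete_of_isColoop M hE hR he hS hlt
      obtain ⟨hT, hST⟩ := hφ' S hS'
      exact ⟨insert_mem_bigY_of_mem_bigY_delete M he hT, hST.trans (subset_insert e _)⟩
  · intro S₁ hS₁ S₂ hS₂ heq
    have he₁ : e ∉ S₁ := notMem_of_mem_lostSets_of_isColoop M hE hR he hS₁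
    have he₂ : e ∉ S₂ := notMem_of_mem_lostSets_of_isColoop M hE hR he hS₂
    -- the images of the small lost sets avoid `e`
    have hφe : ∀ S ∈ lostSets M p q, S.ncard < p - 1 → e ∉ φ' S := by
      intro S hS hlt
      have hS' := mem_lostSets_delete_of_isColoop M hE hR he hS hlt
      obtain ⟨⟨hTE, -, -⟩, -⟩ := (hφ' S hS').1
      rw [delete_ground] at hTE
      exact fun h => (hTE h).2 rfl
    -- removing `e` from both images
    have key : ∀ A B : Set α, e ∉ A → e ∉ B → insert e A = insert e B → A = B := by
      intro A B hA hB hAB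
      have h1 : insert e A \ {e} = insert e B \ {e} := by rw [hAB]
      rwa [insert_sdiff_self_of_notMem hA, insert_sdiff_self_of_notMem hB] at h1
    simp only at heq
    by_cases h₁ : S₁.ncard = p - 1 <;> by_cases h₂ : S₂.ncard = p - 1
    · rw [if_pos h₁, if_pos h₂] at heq
      exact key _ _ he₁ he₂ heq
    · rw [if_pos h₁, if_neg h₂] at heq
      have hlt₂ : S₂.ncard < p - 1 := by have := hS₂.2.2.2.1; omega
      have hS₂' := mem_lostSets_delete_of_isColoop M hE hR he hS₂ hlt₂
      have hA := key _ _ he₁ (hφe S₂ hS₂ hlt₂) heq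
      -- `S₁ = φ' S₂` has rank `q` and rank `> q`
      obtain ⟨⟨hTE, hqT, -⟩, -⟩ := (hφ' S₂ hS₂').1
      rw [delete_ground] at hTE
      rw [eRk_delete_of_subset M hTE, ← hA, hS₁.2.1] at hqT
      exact absurd hqT (lt_irrefl _)
    · rw [if_neg h₁, if_pos h₂] at heq
      have hlt₁ : S₁.ncard < p - 1 := by have := hS₁.2.2.2.1; omega
      have hS₁' := mem_lostSets_delete_of_isColoop M hE hR he hS₁ hlt₁
      have hA := key _ _ (hφe S₁ hS₁ hlt₁) he₂ heq
      obtain ⟨⟨hTE, hqT, -⟩, -⟩ := (hφ' S₁ hS₁').1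
      rw [delete_ground] at hTE
      rw [eRk_delete_of_subset M hTE, hA, hS₂.2.1] at hqT
      exact absurd hqT (lt_irrefl _)
    · rw [if_neg h₁, if_neg h₂] at heq
      have hlt₁ : S₁.ncard < p - 1 := by have := hS₁.2.2.2.1; omega
      have hlt₂ : S₂.ncard < p - 1 := by have := hS₂.2.2.2.1; omega
      have hA := key _ _ (hφe S₁ hS₁ hlt₁) (hφe S₂ hS₂ hlt₂) heq
      exact hinj' (mem_lostSets_delete_of_isColoop M hE hR he hS₁ hlt₁)
        (mem_lostSets_delete_of_isColoop M hE hR he hS₂ hlt₂) hA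

omit [M.Finite] in
/-- The vacuous cells: for `p ≤ q + 1` no set has size strictly between `q` and `p`. -/
theorem lostSets_eq_empty_of_le {p q : ℕ} (h : p ≤ q + 1) : lostSets M p q = ∅ := by
  ext S
  simp only [mem_empty_iff_false, iff_false]
  rintro ⟨-, -, hqS, hSp, -⟩
  omega

omit [M.Finite] in
/-- `(INJ)` holds trivially on the vacuous cells `p ≤ q + 1`. -/
theorem lostInj_of_le {p q : ℕ} (h : p ≤ q + 1) : LostInj M p q :=
  ⟨id, fun S hS => by rw [lostSets_eq_empty_of_le M h] at hS; exact absurd hS (notMem_empty S),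
    fun S hS => by rw [lostSets_eq_empty_of_le M h] at hS; exact absurd hS (notMem_empty S)⟩

omit [M.Finite] in
/-- A coloop of `M` other than `e` is a coloop of `M ＼ {e}`. -/
theorem isColoop_delete_of_isColoop {e f : α} (hf : M.IsColoop f) (hfe : f ≠ e) : (M ＼ {e}).IsColoop f := by
  rw [delete_isColoop_iff]
  exact ⟨hf.notMem_closure_of_notMem (fun h => h.2 rfl), hf.mem_ground, fun h => hfe h⟩

/-- **(INJ) for every rank-`p` matroid with at least `p − q − 1` coloops** (tight layer): iterate the coloop reduction
down to the vacuous cell `p ≤ q + 1`. -/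
theorem lostInj_of_coloops (q : ℕ) : ∀ (p : ℕ) (M : Matroid α) [M.Finite] (C : Set α), (∀ e ∈ C, M.IsColoop e) →
    M.E.ncard = p + q → M.eRank = (p : ℕ∞) → p ≤ q + 1 + C.ncard → LostInj M p q := by
  intro p
  induction p with
  | zero => intro M _ C _ _ _ _; exact lostInj_of_le M (by omega)
  | succ p ih =>
    intro M _ C hC hE hR hcard
    by_cases hsmall : p + 1 ≤ q + 1
    · exact lostInj_of_le M hsmall
    · have hCfin : C.Finite := (M.set_finite M.E).subset (fun e he => (hC e he).mem_ground)
      have hCne : C.Nonempty := by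
        by_contra hne
        rw [not_nonempty_iff_eq_empty] at hne
        rw [hne, ncard_empty] at hcard
        omega
      obtain ⟨e, heC⟩ := hCne
      have he : M.IsColoop e := hC e heC
      refine lostInj_of_isColoop M hE hR he ?_
      have h1 : (p + 1 - 1) = p := by omega
      rw [h1]
      refine ih (M ＼ {e}) (C \ {e}) ?_ ?_ ?_ ?_
      · intro f hf
        exact isColoop_delete_of_isColoop M (hC f hf.1) (fun h => hf.2 (h ▸ rfl))
      · rw [ncard_ground_delete M hE he.mem_ground]; omega
      · have := eRank_delete_of_isColoop M hR (by omega) he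
        rwa [h1] at this
      · rw [ncard_sdiff_singleton_of_mem heC]
        have : 1 ≤ C.ncard := by
          by_contra h0
          have h0' : C.ncard = 0 := by omega
          rw [h0'] at hcard
          omega
        omega

/-- **The UP-Hall form of C-044 at the tight layer for every rank-`p` matroid with at least `p − q − 1` coloops**:
`Φ(p,q)·#𝒜 ≤ #upNbhd(𝒜)` for every family `𝒜` of members (through `(INJ)` and `hallUp_of_ncard_eq_of_lostInj`). -/
theorem hallUp_of_ncard_eq_of_coloops {p q : ℕ} (hE : M.E.ncard = p + q) (hpq : q < p) (hR : M.eRank = (p : ℕ∞))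
    (C : Set α) (hC : ∀ e ∈ C, M.IsColoop e) (hcard : p ≤ q + 1 + C.ncard) :
    ∀ 𝒜 ⊆ cellMembers M p q, phiK p q * (𝒜.ncard : ℚ) ≤ ((upNbhd M p q 𝒜).ncard : ℚ) :=
  hallUp_of_ncard_eq_of_lostInj M p q hE hpq (lostInj_of_coloops q p M C hC hE hR hcard)

end PercRepro
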